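import Summits.QuantumFields.BalabanUV.T4Continuum.Support.VariationalVectorForm
import Summits.QuantumFields.BalabanUV.T4Continuum.Support.VariationalVectorAverage

/-!
# T⁴ programme, spine node NE2 (U1a), lane P2 — «V-GF REFRAMED»: THE GAUGE-SLICE LOWER BRACKET — `pair_bracket_sqrt` with the gauge-functional
# half of the Federbush binder REPLACED by the reachability, inside every coarse fibre, of the set where the coarse form drops to its curl part
# (abstract, the letters of `VariationalCovariantAssemblySqrt.pair_bracket_sqrt`; plus the vector-letter corollaries; model level)

NE2 formalisation swarm `b2b-balaban-t4-ne2-formalise-*`, leaf prover 09 GEN 6 (`prover-b2b-balaban-t4-ne2-formalise-leaf-09-g6-0`); journal DESIGN NOTE +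
INTENT CLAIMS.log 2026-08-20 14:00Z.  On top of the road's spine `VariationalTransfer` ∕ `VariationalAdditive` ∕ `VariationalCovariantAssembly` (p206937 ∕ p210197 ∕
p211487: `blockSpin`, `blockSpin_le`, `blockSpin_eq_of_isMin`, `blockSpin_comp`, `blockSpin_upper_additive`, `exists_isMinOn_fib`, `defect_bound`), of the owner's
`VariationalCovariantAssemblySqrt.pair_bracket_sqrt` (p212859 — re-proved here with ONE binder changed, not imported as a black box) and
`VariationalVectorForm` (p216339), and of leaf-01-g5's V-AVG `VariationalVectorAverage.nsqV_QvL_le_qWV` (p218350) — BY NAME.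

WHY (located while closing leaf V-P, `VariationalVectorGarding` p219068).  `pair_bracket_sqrt` uses its Federbush binder `hFED : Sc (Q₁ f′) ≤ (√(Sf f′) + δ√(qV f′))²`
ONLY at the fine minimiser `g₀` and only to produce ONE competitor `Q₁ g₀` in the coarse fibre.  For a coarse form `Sc = Scc + G` (gauge-invariant curl part +
a gauge functional `G ≥ 0`) the `G`-half of `hFED` — (GF2), «one-step consistency of the gauge term for ALL fine fields» — is the problematic binder (for the
Landau functional under the line-sum average it FAILS: a divergence-free `W′` has `div (Q₁W′) ≠ 0`, p219068's docstring).  But ANY competitor in the same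
fibre does the job, so it suffices that
  (SLICE)  `∀ f, ∃ g, Qk g = Qk f ∧ Sc g ≤ (1 + σ′)·Scc f + σ·qW f`  — the zero set of `G` is reachable INSIDE every `Qk`-fibre, at curl-cost `σ′·curl + σ·size`.
At `U = 1` Bałaban's functional `‖(I − P)∂*A‖²` ([Balaban1984PropagatorsI] (1.69)–(1.70), `R = I − P`) satisfies (SLICE) with `σ = 0`: `P` is built so that
`(I − P)∂*(A + ∂λ) = 0` and `Q∂λ = 0` are jointly solvable (the road's decision (D1) «at U = 1 the printed R∂*A = 0 selects the minimiser, not the value»,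
[B5] p. 26) — a READING, not kernel-proved here (`σ′ = σ = 0`: the gauge move `A ↦ A + ∂λ` leaves `½‖∂A‖²` unchanged; exact toy check d = 1, L = 3,
four blocks: `HOME/b2b-balaban-t4-ne2-formalise-leaf-09/g6/slice_toy_check.py`, reachable 5∕5, illustrative).  The Landau functional `δ⁻¹·divSq` does NOT satisfy (SLICE) with a small `σ`: its zero set `{div W = 0}` is
generically not reachable inside a fibre (`div(W + Dλ) = 0` and `Q(Dλ) = 0` are incompatible), and the fibre-minimum of `½curl² + δ⁻¹div²` exceeds that of `½curl²`
by an `O(1)` fraction — consistent with the numerical (GF2) failure recorded in p219068.  With background, `σ′, σ = O(curvature)` are the expected costs of a gauge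
move (the covariant curl of `D_Rλ` is the commutator `[D_μ, D_ν]λ`; cross term against `curl W` ⟹ the multiplicative `σ′`) — OPEN; this is what «leaf V-GF» should now supply, together with the covariant `P_U`.
 * §1 **`pair_bracket_sqrt_slice`**: `pair_bracket_sqrt`'s hypotheses with `hFED` replaced by `hFEDc : ∀ f′, Scc (Q₁ f′) ≤ (√(Sf f′) + δ√(qV f′))²` (Federbush for
   the CURL part — leaf-01-g5's V-FED shape), (SLICE), and the size contraction `hQ₁size : ∀ f′, qW (Q₁ f′) ≤ qV f′` (V-AVG shape) ⟹ the two one-sided additive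
   brackets with LOWER defect `e = e_F + σ′·(Λ + e_F) + σ·C_P(Λ+1)`, `e_F = 2δ√(Λ·C_P(Λ+1)) + δ²·C_P(Λ+1)`, and the UPPER defect `e′` VERBATIM;
 * §2 vector letters: `sqrt_form_mono` (a curl Federbush against `SfV R′ 0` is one against `SfV R′ G′`, `G′ ≥ 0`), **`vector_pair_bracket_sqrt_slice`** (`Sc := ScV n M R G`,
   `Scc := ScV n M R 0`, averagings DATA), and **`vector_pair_bracket_sqrt_slice_line`** with `Q₁ := QvL L (fine n M) T′` for contractive line transports, where
   `hQ₁size` is DISCHARGED (`qWV_QvL_le_qVV`, from `nsqV_QvL_le_qWV`).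

HONEST FRAMING (T4-DAG p. 1).  Abstract bookkeeping on `blockSpin` at MODEL level; (SLICE), the curl Federbush, UB∕P∕ONE∕REG stay DISPLAYED binders; (SLICE) is
inhabited at `U = 1` (σ = 0) by [B5]'s construction as READ (not proved here) and NOT (with small σ) by `landauG`; with background OPEN.  An OFFERED alternative to (GF2) for a road
owner to ratify — decision (D2) is not changed by this file.  [folklore]; nothing printed is a hypothesis of a theorem; no `def`, no `def … : Prop`, no `sorry`;
axioms standard.  NE2 NOT proved; spine PROVED 0∕9 unchanged; rung (B)+1 finite T⁴ — NOT infinite volume, NOT mass gap, NOT Clay.  HONEST DEPENDENCY (cell,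
verbatim): continuum YM on T⁴ ⇐ BetaPertH ∧ nine spine estimates (0/9 proved); BetaPertH ⇐ (D1) ∧ (D4) ∧ CAP+tail; G-an2-4 gates asym, D1 and NE2/3/4.
-/

noncomputable section

namespace Summit.QuantumFields.BalabanUV.T4Continuum.VariationalAssemblySlice

open Finset
open Literature.MathematicalPhysics.QuantumFieldTheory.Balaban1983to89.B5Prop11Plancherel (Tor fine unitVec)
open Summit.QuantumFields.BalabanUV.T4Continuum.VariationalTransfer (blockSpin blockSpin_le blockSpin_eq_of_isMin blockSpin_comp blockSpin_nonneg')
open Summit.QuantumFields.BalabanUV.T4Continuum.VariationalAdditive (blockSpin_upper_additive)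
open Summit.QuantumFields.BalabanUV.T4Continuum.VariationalCovariantAssembly (exists_isMinOn_fib defect_bound)
open Summit.QuantumFields.BalabanUV.T4Continuum.VectorBlockTrialForm (nsqV nsqV_nonneg QvL)
open Summit.QuantumFields.BalabanUV.T4Continuum.VariationalVectorForm
open Summit.QuantumFields.BalabanUV.T4Continuum.VariationalVectorAverage (nsqV_QvL_le_qWV continuous_QvL)

/-! ## §1 The abstract gauge-slice bracket -/

section Abstract

variable {V W Z : Type*} [NormedAddCommGroup V] [ProperSpace V] [NormedAddCommGroup W] [ProperSpace W] [TopologicalSpace Z] [T1Space Z]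

/-- **THE GAUGE-SLICE BRACKET**: `pair_bracket_sqrt` with its Federbush binder for the FULL coarse form `Sc` replaced by (i) a Federbush bound for a SECOND
coarse functional `Scc` (the curl part), `Scc (Q₁ f′) ≤ (√(Sf f′) + δ√(qV f′))²`, (ii) (SLICE) `∀ f, ∃ g, Qk g = Qk f ∧ Sc g ≤ Scc f + σ′·Scc f + σ·qW f` and
(iii) `qW (Q₁ f′) ≤ qV f′`; the lower defect becomes `e_F + σ′·(Λ + e_F) + σ·C_P(Λ+1)` (`e_F` = `pair_bracket_sqrt`'s), the upper bracket is verbatim.  (The competitor realising the lower bracket is the slice image of `Q₁ g₀`, `g₀` the fine minimiser.)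
[folklore] -/
theorem pair_bracket_sqrt_slice
    {Qk : W → Z} {Q₁ : V → W} {Sc Scc : W → ℝ} {Sf : V → ℝ} {qW : W → ℝ} {qV : V → ℝ} {qZ : Z → ℝ} {ρ : W → ℝ}
    (hQk : Continuous Qk) (hQ₁ : Continuous Q₁) (hSc : Continuous Sc) (hSf : Continuous Sf) (hsurj : Function.Surjective Q₁)
    (hSc0 : ∀ f, 0 ≤ Sc f) (hSf0 : ∀ f', 0 ≤ Sf f') (hqV0 : ∀ f', 0 ≤ qV f') (hqW0 : ∀ f, 0 ≤ qW f) (hqZ0 : ∀ μ, 0 ≤ qZ μ)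
    (hρ0 : ∀ f, 0 ≤ ρ f)
    {κ Λ CP CR δ ε₁ δ' σ σ' : ℝ} (hκ : 0 ≤ κ) (hΛ : 0 ≤ Λ) (hCP : 0 ≤ CP) (hCR : 0 ≤ CR) (hδ : 0 ≤ δ) (hε₁ : 0 ≤ ε₁) (hδ' : 0 ≤ δ')
    (hσ : 0 ≤ σ) (hσ' : 0 ≤ σ')
    (hnormW : ∀ f, ‖f‖ ^ 2 ≤ κ * qW f) (hnormV : ∀ f', ‖f'‖ ^ 2 ≤ κ * qV f')
    -- leaf UB at both levels
    (hUBc : ∀ μ, ∃ f, Qk f = μ ∧ Sc f ≤ Λ * qZ μ) (hUBf : ∀ μ, ∃ f', Qk (Q₁ f') = μ ∧ Sf f' ≤ Λ * qZ μ)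
    -- leaf P at both levels
    (hPc : ∀ f, qW f ≤ CP * (Sc f + qZ (Qk f))) (hPf : ∀ f', qV f' ≤ CP * (Sf f' + qZ (Qk (Q₁ f'))))
    -- Federbush for the CURL PART only, the SLICE, and the size contraction of the average
    (hFEDc : ∀ f', Scc (Q₁ f') ≤ (Real.sqrt (Sf f') + δ * Real.sqrt (qV f')) ^ 2)
    (hslice : ∀ f, ∃ g, Qk g = Qk f ∧ Sc g ≤ Scc f + σ' * Scc f + σ * qW f)
    (hQ₁size : ∀ f', qW (Q₁ f') ≤ qV f')
    -- leaf ONE in the square-root shape, and leaf REG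
    (hONE : ∀ f, blockSpin Q₁ Sf f ≤ (Real.sqrt (Sc f + ε₁ * ρ f) + δ' * Real.sqrt (qW f)) ^ 2)
    (hREG : ∀ μ f, Qk f = μ → (∀ g, Qk g = μ → Sc f ≤ Sc g) → ρ f ≤ CR * (Sc f + qZ μ))
    (μ : Z) :
    blockSpin Qk Sc μ ≤ blockSpin (Qk ∘ Q₁) Sf μ
        + ((2 * δ * Real.sqrt (Λ * (CP * (Λ + 1))) + δ ^ 2 * (CP * (Λ + 1)))
            + σ' * (Λ + (2 * δ * Real.sqrt (Λ * (CP * (Λ + 1))) + δ ^ 2 * (CP * (Λ + 1)))) + σ * (CP * (Λ + 1))) * qZ μ ∧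
      blockSpin (Qk ∘ Q₁) Sf μ ≤ blockSpin Qk Sc μ
        + (ε₁ * CR * (Λ + 1) + 2 * δ' * Real.sqrt ((Λ + ε₁ * CR * (Λ + 1)) * (CP * (Λ + 1))) + δ' ^ 2 * (CP * (Λ + 1))) * qZ μ := by
  -- the coarse minimiser (P coercivity + UB nonemptiness)
  obtain ⟨fU, hfU, hfUb⟩ := hUBc μ
  obtain ⟨f₀, hf₀, hmin⟩ := exists_isMinOn_fib (qZ := qZ) hQk hSc hκ hCP hnormW hPc hfU
  -- the fine minimiser for the composite constraint
  obtain ⟨gU, hgU, hgUb⟩ := hUBf μ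
  have hPf' : ∀ f', qV f' ≤ CP * (Sf f' + qZ ((Qk ∘ Q₁) f')) := fun f' => by simpa using hPf f'
  obtain ⟨g₀, hg₀, hmin'⟩ := exists_isMinOn_fib (Q := Qk ∘ Q₁) (qZ := qZ) (hQk.comp hQ₁) hSf hκ hCP hnormV hPf'
    (f₁ := gU) (by simpa using hgU)
  have hg₀' : Qk (Q₁ g₀) = μ := by simpa using hg₀
  have hminf : ∀ f', Qk (Q₁ f') = μ → Sf g₀ ≤ Sf f' := fun f' hf' => hmin' f' (by simpa using hf')
  -- sizes of the two minimisers
  have hSf_le : Sf g₀ ≤ Λ * qZ μ := (hminf gU hgU).trans hgUb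
  have hSc_le : Sc f₀ ≤ Λ * qZ μ := (hmin fU hfU).trans hfUb
  have hqV_le : qV g₀ ≤ CP * (Λ + 1) * qZ μ := by
    calc qV g₀ ≤ CP * (Sf g₀ + qZ (Qk (Q₁ g₀))) := hPf g₀
      _ ≤ CP * (Λ * qZ μ + qZ μ) := by rw [hg₀']; gcongr
      _ = CP * (Λ + 1) * qZ μ := by ring
  have hqW_le : qW f₀ ≤ CP * (Λ + 1) * qZ μ := by
    calc qW f₀ ≤ CP * (Sc f₀ + qZ (Qk f₀)) := hPc f₀
      _ ≤ CP * (Λ * qZ μ + qZ μ) := by rw [hf₀]; gcongr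
      _ = CP * (Λ + 1) * qZ μ := by ring
  have hρ_le : ρ f₀ ≤ CR * (Λ + 1) * qZ μ := by
    calc ρ f₀ ≤ CR * (Sc f₀ + qZ μ) := hREG μ f₀ hf₀ hmin
      _ ≤ CR * (Λ * qZ μ + qZ μ) := by gcongr
      _ = CR * (Λ + 1) * qZ μ := by ring
  -- the SLICE competitor in the coarse fibre of `μ`, built from `Q₁ g₀`
  obtain ⟨gs, hgsQ, hgsS⟩ := hslice (Q₁ g₀)
  have hgs : Qk gs = μ := by rw [hgsQ, hg₀']
  -- curl Federbush at the fine minimiser + the slice cost: additive defect `e·qZ μ`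
  set eF := 2 * δ * Real.sqrt (Λ * (CP * (Λ + 1))) + δ ^ 2 * (CP * (Λ + 1)) with heF
  have hF : Sc gs ≤ Sf g₀ + (eF + σ' * (Λ + eF) + σ * (CP * (Λ + 1))) * qZ μ := by
    have h := hFEDc g₀
    have hdef := defect_bound (s := Sf g₀) (v := qV g₀) (z := qZ μ) (P := CP * (Λ + 1)) hδ hΛ (by positivity) (hqZ0 μ)
      hSf_le hqV_le
    rw [add_sq, Real.sq_sqrt (hSf0 g₀), mul_pow, Real.sq_sqrt (hqV0 g₀)] at h
    have hT : Scc (Q₁ g₀) ≤ Sf g₀ + eF * qZ μ := by rw [heF]; linarith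
    have hT' : Scc (Q₁ g₀) ≤ (Λ + eF) * qZ μ := by nlinarith [hSf_le]
    have hσT : σ' * Scc (Q₁ g₀) ≤ σ' * ((Λ + eF) * qZ μ) := mul_le_mul_of_nonneg_left hT' hσ'
    have hsz : σ * qW (Q₁ g₀) ≤ σ * (CP * (Λ + 1) * qZ μ) := mul_le_mul_of_nonneg_left ((hQ₁size g₀).trans hqV_le) hσ
    nlinarith [hgsS, hT, hσT, hsz]
  -- the LOWER bracket through the slice competitor
  have hlow : blockSpin Qk Sc μ ≤ blockSpin (Qk ∘ Q₁) Sf μ + (eF + σ' * (Λ + eF) + σ * (CP * (Λ + 1))) * qZ μ := by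
    have hval : blockSpin (Qk ∘ Q₁) Sf μ = Sf g₀ := blockSpin_eq_of_isMin (Q := Qk ∘ Q₁) hSf0 hg₀ hmin'
    rw [hval]
    exact (blockSpin_le hSc0 hgs).trans hF
  -- ONE at the coarse minimiser: the square-root shape becomes an additive defect `e′·qZ μ` (verbatim from `pair_bracket_sqrt`)
  have hc : blockSpin Q₁ Sf f₀ ≤ Sc f₀
      + (ε₁ * CR * (Λ + 1) + 2 * δ' * Real.sqrt ((Λ + ε₁ * CR * (Λ + 1)) * (CP * (Λ + 1))) + δ' ^ 2 * (CP * (Λ + 1))) * qZ μ := by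
    have h := hONE f₀
    have hs0 : 0 ≤ Sc f₀ + ε₁ * ρ f₀ := add_nonneg (hSc0 f₀) (mul_nonneg hε₁ (hρ0 f₀))
    have hs : Sc f₀ + ε₁ * ρ f₀ ≤ (Λ + ε₁ * CR * (Λ + 1)) * qZ μ := by
      nlinarith [hSc_le, mul_le_mul_of_nonneg_left hρ_le hε₁]
    have hΛ' : 0 ≤ Λ + ε₁ * CR * (Λ + 1) := by positivity
    have hdef := defect_bound (s := Sc f₀ + ε₁ * ρ f₀) (v := qW f₀) (z := qZ μ) (Λ := Λ + ε₁ * CR * (Λ + 1)) (P := CP * (Λ + 1))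
      hδ' hΛ' (by positivity) (hqZ0 μ) hs hqW_le
    rw [add_sq, Real.sq_sqrt hs0, mul_pow, Real.sq_sqrt (hqW0 f₀)] at h
    have hρ' : ε₁ * ρ f₀ ≤ ε₁ * CR * (Λ + 1) * qZ μ := by nlinarith [mul_le_mul_of_nonneg_left hρ_le hε₁]
    linarith
  refine ⟨by rw [heF] at hlow; exact hlow, ?_⟩
  rw [blockSpin_comp hsurj hSf0]
  exact blockSpin_upper_additive (fun _ => blockSpin_nonneg' hSf0) hSc0 hf₀ hmin hc

end Abstract

/-! ## §2 Vector letters -/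

section Vector

variable {d : ℕ} {E : Type*} [NormedAddCommGroup E] [NormedSpace ℂ E]
variable (n L : ℕ) [NeZero n] [NeZero L] (M : Fin d → ℕ) [hM : ∀ μ, NeZero (M μ)]

/-- a square-root-shaped competitor bound against a SMALLER fine form is one against a larger one (`G′ ≥ 0`: the curl Federbush against `SfV R′ 0` serves
`SfV R′ G′`). [folklore] -/
theorem sqrt_form_mono {x S S' q δ : ℝ} (hSS : S ≤ S') (hδ : 0 ≤ δ)
    (h : x ≤ (Real.sqrt S + δ * Real.sqrt q) ^ 2) : x ≤ (Real.sqrt S' + δ * Real.sqrt q) ^ 2 := by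
  have h1 : Real.sqrt S ≤ Real.sqrt S' := Real.sqrt_le_sqrt hSS
  have h2 : 0 ≤ Real.sqrt S + δ * Real.sqrt q := by positivity
  exact h.trans (pow_le_pow_left₀ h2 (by linarith) 2)

/-- the pure-curl form at the fine level is below the full fine form when `G′ ≥ 0`. [folklore] -/
theorem SfV_zero_le {R' : Tor (fine L (fine n M)) → Fin d → (E →L[ℂ] E)} {G' : (Tor (fine L (fine n M)) → Fin d → E) → ℝ}
    (hG0' : ∀ W', 0 ≤ G' W') (W' : Tor (fine L (fine n M)) → Fin d → E) :
    SfV n L M R' (fun _ => 0) W' ≤ SfV n L M R' G' W' := by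
  have := hG0' W'
  unfold SfV; gcongr

omit [NeZero L] in
/-- **THE SIZE CONTRACTION OF THE LINE-SUM AVERAGE between the pair's levels**: for contractive line transports,
`qWV n M (QvL L (fine n M) T′ W′) ≤ qVV n L M W′` (leaf-01-g5's `nsqV_QvL_le_qWV` at block side `L`, rescaled). [folklore] -/
theorem qWV_QvL_le_qVV [NeZero L] {T' : Tor (fine n M) → (Fin d → Fin L) → Fin L → Fin d → (E →L[ℂ] E)} (hT' : ∀ y j t μ, ‖T' y j t μ‖ ≤ 1)
    (W' : Tor (fine L (fine n M)) → Fin d → E) :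
    qWV n M (QvL L (fine n M) T' W') ≤ qVV n L M W' := by
  have h := nsqV_QvL_le_qWV L (fine n M) hT' W'
  have hn : (0 : ℝ) < (n : ℝ) ^ d := by have := Nat.pos_of_ne_zero (NeZero.ne n); positivity
  unfold qWV at h ⊢
  unfold qVV
  calc ((n : ℝ) ^ d)⁻¹ * nsqV (fine n M) (QvL L (fine n M) T' W')
      ≤ ((n : ℝ) ^ d)⁻¹ * (((L : ℝ) ^ d)⁻¹ * nsqV (fine L (fine n M)) W') := mul_le_mul_of_nonneg_left h (by positivity)
    _ = (((n : ℝ) * L) ^ d)⁻¹ * nsqV (fine L (fine n M)) W' := by rw [mul_pow, mul_inv]; ring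

/-- **THE GAUGE-SLICE BRACKET FOR THE VECTOR CANONICAL PAIR, AVERAGINGS DATA** (`E` finite-dimensional): `vector_pair_bracket_sqrt` with the Federbush binder for
the FULL form `ScV R G` replaced by the CURL Federbush `ScV R 0 (Q₁ W′) ≤ (√(SfV R′ G′ W′) + δ√(qVV W′))²`, the SLICE
`∀ W, ∃ W̃, Qk W̃ = Qk W ∧ ScV R G W̃ ≤ (1 + σ′)·ScV R 0 W + σ·qWV W` and the size contraction `qWV (Q₁ W′) ≤ qVV W′`; lower defect `e_F + σ′(Λ + e_F) + σ·C_P(Λ+1)`,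
upper verbatim. [folklore] -/
theorem vector_pair_bracket_sqrt_slice [FiniteDimensional ℂ E]
    {R : Tor (fine n M) → Fin d → (E →L[ℂ] E)} {R' : Tor (fine L (fine n M)) → Fin d → (E →L[ℂ] E)}
    {G : (Tor (fine n M) → Fin d → E) → ℝ} {G' : (Tor (fine L (fine n M)) → Fin d → E) → ℝ}
    {Qk : (Tor (fine n M) → Fin d → E) → (Tor M → Fin d → E)} {Q₁ : (Tor (fine L (fine n M)) → Fin d → E) → (Tor (fine n M) → Fin d → E)}
    (hQk : Continuous Qk) (hQ₁ : Continuous Q₁) (hsurj : Function.Surjective Q₁)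
    (hG0 : ∀ W, 0 ≤ G W) (hGc : Continuous G) (hG0' : ∀ W', 0 ≤ G' W') (hGc' : Continuous G')
    {Λ CP CR δ ε₁ δ' σ σ' : ℝ} (hΛ : 0 ≤ Λ) (hCP : 0 ≤ CP) (hCR : 0 ≤ CR) (hδ : 0 ≤ δ) (hε₁ : 0 ≤ ε₁) (hδ' : 0 ≤ δ') (hσ : 0 ≤ σ)
    (hσ' : 0 ≤ σ') {ρ : (Tor (fine n M) → Fin d → E) → ℝ} (hρ0 : ∀ W, 0 ≤ ρ W)
    (hUBc : ∀ φ : Tor M → Fin d → E, ∃ W, Qk W = φ ∧ ScV n M R G W ≤ Λ * nsqV M φ)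
    (hUBf : ∀ φ : Tor M → Fin d → E, ∃ W', Qk (Q₁ W') = φ ∧ SfV n L M R' G' W' ≤ Λ * nsqV M φ)
    (hPc : ∀ W, qWV n M W ≤ CP * (ScV n M R G W + nsqV M (Qk W)))
    (hPf : ∀ W', qVV n L M W' ≤ CP * (SfV n L M R' G' W' + nsqV M (Qk (Q₁ W'))))
    -- Federbush for the CURL part, the SLICE, the size contraction
    (hFEDc : ∀ W', ScV n M R (fun _ => 0) (Q₁ W') ≤ (Real.sqrt (SfV n L M R' G' W') + δ * Real.sqrt (qVV n L M W')) ^ 2)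
    (hslice : ∀ W, ∃ Ws, Qk Ws = Qk W ∧ ScV n M R G Ws ≤ ScV n M R (fun _ => 0) W + σ' * ScV n M R (fun _ => 0) W + σ * qWV n M W)
    (hQ₁size : ∀ W', qWV n M (Q₁ W') ≤ qVV n L M W')
    (hONE : ∀ W, blockSpin Q₁ (SfV n L M R' G') W ≤ (Real.sqrt (ScV n M R G W + ε₁ * ρ W) + δ' * Real.sqrt (qWV n M W)) ^ 2)
    (hREG : ∀ (φ : Tor M → Fin d → E) W, Qk W = φ → (∀ W₂, Qk W₂ = φ → ScV n M R G W ≤ ScV n M R G W₂) →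
      ρ W ≤ CR * (ScV n M R G W + nsqV M φ))
    (φ : Tor M → Fin d → E) :
    blockSpin Qk (ScV n M R G) φ ≤ blockSpin (Qk ∘ Q₁) (SfV n L M R' G') φ
        + ((2 * δ * Real.sqrt (Λ * (CP * (Λ + 1))) + δ ^ 2 * (CP * (Λ + 1)))
            + σ' * (Λ + (2 * δ * Real.sqrt (Λ * (CP * (Λ + 1))) + δ ^ 2 * (CP * (Λ + 1)))) + σ * (CP * (Λ + 1))) * nsqV M φ ∧
      blockSpin (Qk ∘ Q₁) (SfV n L M R' G') φ ≤ blockSpin Qk (ScV n M R G) φ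
        + (ε₁ * CR * (Λ + 1) + 2 * δ' * Real.sqrt ((Λ + ε₁ * CR * (Λ + 1)) * (CP * (Λ + 1))) + δ' ^ 2 * (CP * (Λ + 1))) * nsqV M φ := by
  have hL1 : (1 : ℝ) ≤ L := by exact_mod_cast Nat.one_le_iff_ne_zero.mpr (NeZero.ne L)
  have hn0 : (0 : ℝ) < (n : ℝ) ^ d := by have := Nat.pos_of_ne_zero (NeZero.ne n); positivity
  have hnLd : (0 : ℝ) ≤ ((n : ℝ) * L) ^ d := by positivity
  have hnormW : ∀ W : Tor (fine n M) → Fin d → E, ‖W‖ ^ 2 ≤ ((n : ℝ) * L) ^ d * qWV n M W := fun W => by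
    refine (norm_sq_le_nsqV W).trans ?_
    unfold qWV
    rw [mul_pow, mul_comm ((n : ℝ) ^ d), mul_assoc, ← mul_assoc ((n : ℝ) ^ d), mul_inv_cancel₀ hn0.ne', one_mul]
    exact le_mul_of_one_le_left (nsqV_nonneg _ W) (one_le_pow₀ hL1)
  have hnormV : ∀ W' : Tor (fine L (fine n M)) → Fin d → E, ‖W'‖ ^ 2 ≤ ((n : ℝ) * L) ^ d * qVV n L M W' := fun W' => by
    have hnL : (0 : ℝ) < ((n : ℝ) * L) ^ d := by have := Nat.pos_of_ne_zero (NeZero.ne n); positivity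
    unfold qVV
    rw [← mul_assoc, mul_inv_cancel₀ hnL.ne', one_mul]
    exact norm_sq_le_nsqV W'
  exact pair_bracket_sqrt_slice (V := Tor (fine L (fine n M)) → Fin d → E) (W := Tor (fine n M) → Fin d → E) (Z := Tor M → Fin d → E)
    (Qk := Qk) (Q₁ := Q₁) (Sc := ScV n M R G) (Scc := ScV n M R (fun _ => 0)) (Sf := SfV n L M R' G') (qW := qWV n M) (qV := qVV n L M)
    (qZ := nsqV M) (ρ := ρ)
    hQk hQ₁ (continuous_ScV n M R hGc) (continuous_SfV n L M R' hGc') hsurj (ScV_nonneg n M R hG0) (SfV_nonneg n L M R' hG0')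
    (qVV_nonneg n L M) (qWV_nonneg n M) (nsqV_nonneg M) hρ0 hnLd hΛ hCP hCR hδ hε₁ hδ' hσ hσ' hnormW hnormV hUBc hUBf hPc hPf hFEDc hslice hQ₁size
    hONE hREG φ

/-- **THE GAUGE-SLICE BRACKET ON THE ROAD's LINE-INDEXED ONE-STEP AVERAGE**: `Q₁ := QvL L (fine n M) T′` with contractive line transports — the size
contraction `hQ₁size` is DISCHARGED by leaf-01-g5's V-AVG, and the curl Federbush may be given against the pure-curl fine form `SfV R′ 0` (monotone in `G′ ≥ 0`);
`Qk` DATA (continuous), `Q₁` onto displayed (V-UB-L's exact constraint). [folklore] -/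
theorem vector_pair_bracket_sqrt_slice_line [FiniteDimensional ℂ E]
    {R : Tor (fine n M) → Fin d → (E →L[ℂ] E)} {R' : Tor (fine L (fine n M)) → Fin d → (E →L[ℂ] E)}
    {G : (Tor (fine n M) → Fin d → E) → ℝ} {G' : (Tor (fine L (fine n M)) → Fin d → E) → ℝ}
    {Qk : (Tor (fine n M) → Fin d → E) → (Tor M → Fin d → E)} {T' : Tor (fine n M) → (Fin d → Fin L) → Fin L → Fin d → (E →L[ℂ] E)}
    (hQk : Continuous Qk) (hT' : ∀ y j t μ, ‖T' y j t μ‖ ≤ 1) (hsurj : Function.Surjective (QvL L (fine n M) T'))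
    (hG0 : ∀ W, 0 ≤ G W) (hGc : Continuous G) (hG0' : ∀ W', 0 ≤ G' W') (hGc' : Continuous G')
    {Λ CP CR δ ε₁ δ' σ σ' : ℝ} (hΛ : 0 ≤ Λ) (hCP : 0 ≤ CP) (hCR : 0 ≤ CR) (hδ : 0 ≤ δ) (hε₁ : 0 ≤ ε₁) (hδ' : 0 ≤ δ') (hσ : 0 ≤ σ)
    (hσ' : 0 ≤ σ') {ρ : (Tor (fine n M) → Fin d → E) → ℝ} (hρ0 : ∀ W, 0 ≤ ρ W)
    (hUBc : ∀ φ : Tor M → Fin d → E, ∃ W, Qk W = φ ∧ ScV n M R G W ≤ Λ * nsqV M φ)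
    (hUBf : ∀ φ : Tor M → Fin d → E, ∃ W', Qk (QvL L (fine n M) T' W') = φ ∧ SfV n L M R' G' W' ≤ Λ * nsqV M φ)
    (hPc : ∀ W, qWV n M W ≤ CP * (ScV n M R G W + nsqV M (Qk W)))
    (hPf : ∀ W', qVV n L M W' ≤ CP * (SfV n L M R' G' W' + nsqV M (Qk (QvL L (fine n M) T' W'))))
    -- the CURL Federbush against the pure-curl fine form, and the SLICE
    (hFEDcurl : ∀ W', ScV n M R (fun _ => 0) (QvL L (fine n M) T' W')
      ≤ (Real.sqrt (SfV n L M R' (fun _ => 0) W') + δ * Real.sqrt (qVV n L M W')) ^ 2)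
    (hslice : ∀ W, ∃ Ws, Qk Ws = Qk W ∧ ScV n M R G Ws ≤ ScV n M R (fun _ => 0) W + σ' * ScV n M R (fun _ => 0) W + σ * qWV n M W)
    (hONE : ∀ W, blockSpin (QvL L (fine n M) T') (SfV n L M R' G') W ≤ (Real.sqrt (ScV n M R G W + ε₁ * ρ W) + δ' * Real.sqrt (qWV n M W)) ^ 2)
    (hREG : ∀ (φ : Tor M → Fin d → E) W, Qk W = φ → (∀ W₂, Qk W₂ = φ → ScV n M R G W ≤ ScV n M R G W₂) →
      ρ W ≤ CR * (ScV n M R G W + nsqV M φ))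
    (φ : Tor M → Fin d → E) :
    blockSpin Qk (ScV n M R G) φ ≤ blockSpin (Qk ∘ QvL L (fine n M) T') (SfV n L M R' G') φ
        + ((2 * δ * Real.sqrt (Λ * (CP * (Λ + 1))) + δ ^ 2 * (CP * (Λ + 1)))
            + σ' * (Λ + (2 * δ * Real.sqrt (Λ * (CP * (Λ + 1))) + δ ^ 2 * (CP * (Λ + 1)))) + σ * (CP * (Λ + 1))) * nsqV M φ ∧
      blockSpin (Qk ∘ QvL L (fine n M) T') (SfV n L M R' G') φ ≤ blockSpin Qk (ScV n M R G) φ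
        + (ε₁ * CR * (Λ + 1) + 2 * δ' * Real.sqrt ((Λ + ε₁ * CR * (Λ + 1)) * (CP * (Λ + 1))) + δ' ^ 2 * (CP * (Λ + 1))) * nsqV M φ := by
  have hFEDc : ∀ W', ScV n M R (fun _ => 0) (QvL L (fine n M) T' W')
      ≤ (Real.sqrt (SfV n L M R' G' W') + δ * Real.sqrt (qVV n L M W')) ^ 2 := fun W' =>
    sqrt_form_mono (SfV_zero_le n L M hG0' W') hδ (hFEDcurl W')
  exact vector_pair_bracket_sqrt_slice n L M hQk (continuous_QvL L (fine n M) T') hsurj hG0 hGc hG0' hGc' hΛ hCP hCR hδ hε₁ hδ' hσ hσ' hρ0 hUBc hUBf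
    hPc hPf hFEDc hslice (qWV_QvL_le_qVV n L M hT') hONE hREG φ

end Vector

end Summit.QuantumFields.BalabanUV.T4Continuum.VariationalAssemblySlice

end
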